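import Literature.MathematicalPhysics.KineticTheory.SiteChainLangevinKernel
import Literature.MathematicalPhysics.KineticTheory.ConfinedDuality
import HarnessLib

/-!
# The time-reversed Langevin dynamics of a site-inhomogeneous chain and the duality of its kernels

Topic `Literature/MathematicalPhysics/KineticTheory`, grouping namespace `…KineticTheory.HeatConduction`.
Twin, for the SITE-DEPENDENT chains `SiteChain` of `CellChain.lean` under the hypothesis structure
`SiteChain.UniformlyConfining` (`SiteChainConfined.lean`), of `LangevinChainReversal.lean`: the
Langevin drift `Y(q, p) = (p, -∇Φ(q) - γ 1_B p)` (`SiteChain.langevinDrift`, Cuneo–Eckmann–Hairer–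
Rey-Bellet 2018 eq. (2.2) on the path graph) has CONSTANT divergence `tr DY = -2γ` (`N ≥ 1`; only
the two friction terms contribute — no smoothness beyond `C²` potentials is needed, the force
part depends on the positions only), and its reversal `-Y` is again a regular confined drift for
the same energy `H`. Hence the model-free time-reversal theory (`ConfinedDuality.lean`) applies to
the transition kernels `SiteChain.langevinKernel`:

* `SiteChain.trace_fderiv_langevinDrift_U2` — `tr DY ≡ -2γ`;
* `SiteChain.UniformlyConfining.reversedDrift` — `-Y` as a `RegularConfinedDrift`;
  `SiteChain.langevinRevKernel` — the transition kernels `P̂_t` of the reversed equation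
  `dz = -Y(z) dt + v_L dB^L + v_R dB^R` (Markov, Feller, jointly measurable, continuous in time);
* `SiteChain.UniformlyConfining.compProd_langevinKernel_eq` — **duality**
  `dx P_t(x, dy) = e^{2γt} dy P̂_t(y, dx)`, with the Lebesgue-integral and Bochner forms,
  `∫ P̂_t(y, A) dy = e^{-2γt}|A|`, and the contraction `∫ dy ∫ g dP̂_t(y,·) ≤ ∫ g dx`.

## References

* N. Cuneo, J.-P. Eckmann, M. Hairer, L. Rey-Bellet, *Non-equilibrium steady states for networks of
  oscillators*, Electron. J. Probab. **23** (2018) no. 55, eq. (2.2), §3.1 (`L*` is the formal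
  adjoint of the generator).
* U. G. Haussmann, É. Pardoux, *Time reversal of diffusions*, Ann. Probab. **14** (1986) 1188–1205.

## Design choices

* Hypotheses are `hP : P.UniformlyConfining` and `0 < N` throughout (the `OscillatorChain` twin asks
  for `C^∞` potentials because it computes the full Jacobian `DY`; here only the diagonal blocks
  of `DY` are computed, for which `C²` potentials suffice).
* NOT here: Duhamel's formula for `P̂_t` (`SiteChainDualityDuhamel.lean`), the Fokker–Planck
  identification (`SiteChainFokkerPlanck*.lean`), the backward equation.
-/

noncomputable section

open MeasureTheory ProbabilityTheory Filter Topology Set Function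
open scoped NNReal ENNReal ContDiff

namespace Literature.MathematicalPhysics.KineticTheory.HeatConduction

open Literature.Probability.Process Literature.MathematicalPhysics.KineticTheory

variable {N : ℕ}

namespace SiteChain

variable (P : SiteChain)

/-! ### The diagonal blocks of `DY` and the divergence `tr DY = -2γ` -/

/-- `∂Y/∂p_j = (e_j, -γ ([j = 0] + [j = N-1]) e_j)` for the Langevin drift of a site-dependent
chain with differentiable potentials (the drift is affine in the momenta). [folklore] -/
theorem hasLineDerivAt_langevinDrift_unitP_U2 (hU : ∀ i, Differentiable ℝ (P.U i))
    (hV : ∀ i, Differentiable ℝ (P.V i)) (N : ℕ) (x : PhaseSpace N) (j : Fin N) :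
    HasLineDerivAt ℝ (P.langevinDrift N)
      ((Pi.single j 1, fun i => if i = j then -(P.γ * OscillatorChain.bathWeight N i) else 0) : PhaseSpace N)
      x (unitP j) := by
  unfold HasLineDerivAt
  rw [P.langevinDrift_eq hU hV]
  simp only [unitP_eq, add_smul_unitP_fst, add_smul_unitP_snd]
  have hlin : HasDerivAt (fun t : ℝ => x.2 + t • (Pi.single j (1 : ℝ) : Fin N → ℝ))
      (Pi.single j 1) 0 := by
    simpa using ((hasDerivAt_id (0 : ℝ)).smul_const (Pi.single j (1 : ℝ) : Fin N → ℝ)).const_add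
      x.2
  have hco : ∀ m : Fin N, HasDerivAt (fun t : ℝ => (x.2 + t • (Pi.single j (1 : ℝ) : Fin N → ℝ)) m)
      (if m = j then 1 else 0) 0 := fun m => by
    have := (hasDerivAt_pi.1 hlin) m
    simpa [Pi.single_apply] using this
  refine hlin.prodMk (hasDerivAt_pi.2 fun i => ?_)
  have h2 := ((hco i).const_mul (P.γ * OscillatorChain.bathWeight N i)).const_sub (-P.dPotential N i x.1)
  convert h2 using 1
  split_ifs <;> ring

/-- The momentum block of `DY`: `DY(x)(0, e_j) = (e_j, -γ w_j e_j)` (`C²` potentials). [folklore] -/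
theorem fderiv_langevinDrift_unitP_U2 (hU : ∀ i, ContDiff ℝ 2 (P.U i)) (hV : ∀ i, ContDiff ℝ 2 (P.V i))
    (N : ℕ) (x : PhaseSpace N) (j : Fin N) :
    fderiv ℝ (P.langevinDrift N) x (unitP j) =
      ((Pi.single j 1, fun i => if i = j then -(P.γ * OscillatorChain.bathWeight N i) else 0) : PhaseSpace N) := by
  have hd : DifferentiableAt ℝ (P.langevinDrift N) x :=
    ((P.contDiff_one_langevinDrift hU hV N).differentiable one_ne_zero) x
  rw [← hd.lineDeriv_eq_fderiv]
  exact (P.hasLineDerivAt_langevinDrift_unitP_U2 (fun i => (hU i).differentiable (by norm_num))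
    (fun i => (hV i).differentiable (by norm_num)) N x j).lineDeriv

/-- The position row of `DY`: `(DY(x) v).1 = v.2` (the first component of `Y` is the momentum).
[folklore] -/
theorem fderiv_langevinDrift_apply_fst_U2 (hU : ∀ i, ContDiff ℝ 2 (P.U i)) (hV : ∀ i, ContDiff ℝ 2 (P.V i))
    (N : ℕ) (x v : PhaseSpace N) : (fderiv ℝ (P.langevinDrift N) x v).1 = v.2 := by
  have hd : DifferentiableAt ℝ (P.langevinDrift N) x :=
    ((P.contDiff_one_langevinDrift hU hV N).differentiable one_ne_zero) x
  have h1 : HasFDerivAt (fun y => (P.langevinDrift N y).1)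
      ((ContinuousLinearMap.fst ℝ (Fin N → ℝ) (Fin N → ℝ)).comp (fderiv ℝ (P.langevinDrift N) x)) x :=
    hd.hasFDerivAt.fst
  have h2 : HasFDerivAt (fun y : PhaseSpace N => (P.langevinDrift N y).1)
      (ContinuousLinearMap.snd ℝ (Fin N → ℝ) (Fin N → ℝ)) x := by
    have e : (fun y : PhaseSpace N => (P.langevinDrift N y).1) = Prod.snd := rfl
    rw [e]
    exact hasFDerivAt_snd
  have h := h1.unique h2
  have := congrArg (fun L : PhaseSpace N →L[ℝ] (Fin N → ℝ) => L v) h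
  simpa using this

/-- **The divergence of the Langevin drift of a site-dependent chain is the constant `-2γ`**
(`N ≥ 1`, `C²` potentials): `tr DY(x) = -γ ∑_i ([i=0] + [i=N-1]) = -2γ` — only the friction terms
`-γ p_b ∂_{p_b}` contribute. [folklore] -/
theorem trace_fderiv_langevinDrift_U2 (hU : ∀ i, ContDiff ℝ 2 (P.U i)) (hV : ∀ i, ContDiff ℝ 2 (P.V i))
    (hN : 0 < N) (x : PhaseSpace N) :
    LinearMap.trace ℝ (PhaseSpace N)
        (fderiv ℝ (P.langevinDrift N) x : PhaseSpace N →ₗ[ℝ] PhaseSpace N) = -(2 * P.γ) := by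
  classical
  let b := (Pi.basisFun ℝ (Fin N)).prod (Pi.basisFun ℝ (Fin N))
  rw [LinearMap.trace_eq_matrix_trace ℝ b, Matrix.trace]
  simp only [Matrix.diag_apply, LinearMap.toMatrix_apply, ContinuousLinearMap.coe_coe,
    Fintype.sum_sum_type, b, Module.Basis.prod_repr_inl, Module.Basis.prod_repr_inr,
    Pi.basisFun_repr, Module.Basis.prod_apply, Pi.basisFun_apply, Sum.elim_inl, Sum.elim_inr,
    LinearMap.coe_inl, LinearMap.coe_inr, Function.comp_apply]
  have h1 : ∀ j : Fin N, (fderiv ℝ (P.langevinDrift N) x (Pi.single j 1, 0)).1 j = 0 := fun j => by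
    rw [P.fderiv_langevinDrift_apply_fst_U2 hU hV]
    rfl
  have h2 : ∀ j : Fin N, (fderiv ℝ (P.langevinDrift N) x (0, Pi.single j 1)).2 j =
      -(P.γ * OscillatorChain.bathWeight N j) := fun j => by
    rw [← unitP_eq, P.fderiv_langevinDrift_unitP_U2 hU hV]
    simp
  simp only [h1, h2, Finset.sum_const_zero, zero_add, Finset.sum_neg_distrib, ← Finset.mul_sum,
    OscillatorChain.sum_bathWeight hN]
  ring

/-! ### The reversed drift is a regular confined drift -/

namespace UniformlyConfining

variable {P}

/-- **The reversed Langevin drift `-Y` of a site-dependent chain is a regular confined drift** for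
the same energy `H`, constant, radius and noise subspace as `UniformlyConfining.confinedDrift`: the
upper energy balance of `-Y` is the lower one of `Y` (the anti-friction `+γ∑_B p_b²` is at most
`4γ(H + 1)`) and vice versa. [folklore] -/
def reversedDrift (hP : P.UniformlyConfining) (N : ℕ) : RegularConfinedDrift (fun y => -P.langevinDrift N y) :=
  let D := hP.confinedDrift N
  { V := D.V
    c := D.c
    K := D.K'
    ρ := D.ρ
    noise := D.noise
    contDiff_drift := D.contDiff_drift.neg
    differentiable_energy := D.differentiable_energy
    energy_nonneg := D.energy_nonneg
    rate_nonneg := D.rate'_nonneg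
    fderiv_energy_le := fun M y e he heM => by
      rw [map_neg]
      have h := D.fderiv_energy_ge M y e he heM
      linarith
    norm_le_radius := D.norm_le_radius
    radius_mono := D.radius_mono
    K' := D.K
    Kshift := D.Kshift
    rate_mono := D.rate'_mono
    rate'_nonneg := D.rate_nonneg
    rate'_mono := D.rate_mono
    Kshift_nonneg := D.Kshift_nonneg
    fderiv_energy_ge := fun M y e he heM => by
      rw [map_neg]
      have h := D.fderiv_energy_le M y e he heM
      linarith
    energy_shift_le := D.energy_shift_le }

/-- The noise subspace of the reversed drift is the momentum subspace. [folklore] -/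
@[simp] theorem reversedDrift_noise (hP : P.UniformlyConfining) (N : ℕ) :
    (hP.reversedDrift N).noise = momentumSubspace N := rfl

/-- The energy of the reversed drift is `H`. [folklore] -/
@[simp] theorem reversedDrift_V (hP : P.UniformlyConfining) (N : ℕ) :
    (hP.reversedDrift N).V = P.hamiltonian N := rfl

/-- `v_L` lies in the noise subspace of the reversed drift. [folklore] -/
theorem noiseVecL_mem_reversedDrift_noise (hP : P.UniformlyConfining) (N : ℕ) (T_L : ℝ) :
    P.noiseVecL N T_L ∈ (hP.reversedDrift N).noise :=
  bathVec_mem_momentumSubspace N _ _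

/-- `v_R` lies in the noise subspace of the reversed drift. [folklore] -/
theorem noiseVecR_mem_reversedDrift_noise (hP : P.UniformlyConfining) (N : ℕ) (T_R : ℝ) :
    P.noiseVecR N T_R ∈ (hP.reversedDrift N).noise :=
  bathVec_mem_momentumSubspace N _ _

end UniformlyConfining

/-! ### The reversed transition kernels -/

/-- **The transition kernels `P̂_t` of the time-reversed Langevin equation of a site-dependent
chain** `dz = -Y(z) dt + v_L dB^L + v_R dB^R` (same bath noise `noiseVecL/R`), via `sdeKernel` of the
model-free pipeline. [folklore] -/
def langevinRevKernel (N : ℕ) (T_L T_R : ℝ) (t : ℝ≥0) : Kernel (PhaseSpace N) (PhaseSpace N) :=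
  sdeKernel (fun y => -P.langevinDrift N y) (P.noiseVecL N T_L) (P.noiseVecR N T_R) t

namespace UniformlyConfining

variable {P} (hP : P.UniformlyConfining) (N : ℕ) (T_L T_R : ℝ)
include hP

/-- The reversed kernels are Markov kernels. [folklore] -/
theorem isMarkovKernel_langevinRevKernel (t : ℝ≥0) :
    IsMarkovKernel (P.langevinRevKernel N T_L T_R t) :=
  (hP.reversedDrift N).toConfinedDrift.isMarkovKernel_sdeKernel
    (hP.noiseVecL_mem_reversedDrift_noise N T_L) (hP.noiseVecR_mem_reversedDrift_noise N T_R) t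

/-- The reversed kernels are probability measures. [folklore] -/
theorem isProbabilityMeasure_langevinRevKernel (t : ℝ≥0) (z : PhaseSpace N) :
    IsProbabilityMeasure (P.langevinRevKernel N T_L T_R t z) :=
  (hP.isMarkovKernel_langevinRevKernel N T_L T_R t).isProbabilityMeasure z

/-- **The reversed kernels are Feller**: `y ↦ ∫ g dP̂_t(y, ·)` is continuous for bounded continuous
`g`. [folklore] -/
theorem continuous_integral_langevinRevKernel (t : ℝ≥0) {g : PhaseSpace N → ℝ} (hg : Continuous g)
    {C : ℝ} (hC : ∀ y, ‖g y‖ ≤ C) :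
    Continuous fun y => ∫ x, g x ∂(P.langevinRevKernel N T_L T_R t y) :=
  (hP.reversedDrift N).toConfinedDrift.continuous_integral_sdeKernel
    (hP.noiseVecL_mem_reversedDrift_noise N T_L) (hP.noiseVecR_mem_reversedDrift_noise N T_R) t hg hC

/-- For bounded continuous `g`, `s ↦ ∫ g dP̂_{s⁺}(z, ·)` is continuous (dominated convergence along
the continuous flow of the reversed equation). [folklore] -/
theorem continuous_integral_langevinRevKernel_toNNReal (z : PhaseSpace N) {g : PhaseSpace N → ℝ}
    (hg : Continuous g) {C : ℝ} (hC : ∀ y, ‖g y‖ ≤ C) :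
    Continuous fun s : ℝ => ∫ y, g y ∂(P.langevinRevKernel N T_L T_R s.toNNReal z) := by
  set D := hP.reversedDrift N with hD
  have hv₁ := hP.noiseVecL_mem_reversedDrift_noise N T_L
  have hv₂ := hP.noiseVecR_mem_reversedDrift_noise N T_R
  have hrep : (fun s : ℝ => ∫ y, g y ∂(P.langevinRevKernel N T_L T_R s.toNNReal z)) = fun s =>
      ∫ w, g (sdeSolMap (fun y => -P.langevinDrift N y) (P.noiseVecL N T_L) (P.noiseVecR N T_R)
        (s.toNNReal : ℝ) z (pairPath w)) ∂wienerPair := by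
    funext s
    exact D.toConfinedDrift.integral_sdeKernel hv₁ hv₂ _ z hg.aestronglyMeasurable
  rw [hrep]
  have hflow_cont : ∀ w, Continuous fun s : ℝ => sdeSolMap (fun y => -P.langevinDrift N y)
      (P.noiseVecL N T_L) (P.noiseVecR N T_R) (s.toNNReal : ℝ) z (pairPath w) :=
    fun w => (D.toConfinedDrift.continuous_sdeSolMap hv₁ hv₂ z (pairPath w)).comp
      (continuous_subtype_val.comp continuous_real_toNNReal)
  have hflow_meas : ∀ s : ℝ, Measurable fun w => sdeSolMap (fun y => -P.langevinDrift N y)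
      (P.noiseVecL N T_L) (P.noiseVecR N T_R) (s.toNNReal : ℝ) z (pairPath w) :=
    fun s => D.toConfinedDrift.measurable_sdeSolMap_pairPath_right hv₁ hv₂ _ z
  exact continuous_of_dominated (fun s => (hg.measurable.comp (hflow_meas s)).aestronglyMeasurable)
    (fun s => Eventually.of_forall fun w => hC _) (integrable_const C)
    (Eventually.of_forall fun w => hg.comp (hflow_cont w))

/-- Joint measurability of `(t, y) ↦ P̂_t(y, ·)`. [folklore] -/
theorem measurable_langevinRevKernel :
    Measurable fun q : ℝ≥0 × PhaseSpace N => P.langevinRevKernel N T_L T_R q.1 q.2 :=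
  (hP.reversedDrift N).toConfinedDrift.measurable_sdeKernel
    (hP.noiseVecL_mem_reversedDrift_noise N T_L) (hP.noiseVecR_mem_reversedDrift_noise N T_R)

/-- `(y, s) ↦ ∫ g dP̂_{s⁺}(y, ·)` is measurable for measurable `g ≥ 0`. [folklore] -/
theorem measurable_lintegral_langevinRevKernel {g : PhaseSpace N → ℝ≥0∞} (hg : Measurable g) :
    Measurable fun p : PhaseSpace N × ℝ =>
      ∫⁻ x, g x ∂(P.langevinRevKernel N T_L T_R p.2.toNNReal p.1) := by
  have h2 : Measurable fun p : PhaseSpace N × ℝ => (p.2.toNNReal, p.1) :=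
    (measurable_real_toNNReal.comp measurable_snd).prodMk measurable_fst
  have h3 := (hP.measurable_langevinRevKernel N T_L T_R).comp h2
  exact (Measure.measurable_lintegral hg).comp h3

/-! ### Duality with respect to Lebesgue measure -/

variable {N} (hN : 0 < N)
include hN

/-- **Duality of the transition kernels of a site-dependent Langevin chain with respect to
Lebesgue measure**, measure form: `dx P_t(x, dy) = e^{2γt} · swap_*(dy P̂_t(y, dx))` on `Ω × Ω` for
`t > 0` (`tr DY = -2γ`; `ConfinedDuality.lean`). [folklore] -/
theorem compProd_langevinKernel_eq {t : ℝ≥0} (ht : 0 < t) :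
    (volume : Measure (PhaseSpace N)) ⊗ₘ P.langevinKernel N T_L T_R t =
      ENNReal.ofReal (Real.exp (2 * P.γ * t)) •
        ((volume : Measure (PhaseSpace N)) ⊗ₘ P.langevinRevKernel N T_L T_R t).map Prod.swap := by
  haveI : (volume : Measure (PhaseSpace N)).IsAddHaarMeasure := Measure.prod.instIsAddHaarMeasure _ _
  have h := (hP.confinedDrift N).toConfinedDrift.compProd_sdeKernel_eq_smul_map_swap
    (hP.reversedDrift N).toConfinedDrift
    (hP.noiseVecL_mem_noise N T_L) (hP.noiseVecR_mem_noise N T_R)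
    (hP.noiseVecL_mem_reversedDrift_noise N T_L) (hP.noiseVecR_mem_reversedDrift_noise N T_R)
    volume (fun _ => rfl) (P.trace_fderiv_langevinDrift_U2 hP.contDiff_U hP.contDiff_V hN) ht
  rw [show -(-(2 * P.γ) * (t : ℝ)) = 2 * P.γ * t by ring] at h
  exact h

/-- Duality, Lebesgue-integral form: `∫ dx ∫ P_t(x,dy) H(x,y) = e^{2γt} ∫ dy ∫ P̂_t(y,dx) H(x,y)`
for measurable `H ≥ 0`, `t > 0`. [folklore] -/
theorem lintegral_langevinKernel_duality {t : ℝ≥0} (ht : 0 < t)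
    {H : PhaseSpace N × PhaseSpace N → ℝ≥0∞} (hH : Measurable H) :
    ∫⁻ x, ∫⁻ y, H (x, y) ∂(P.langevinKernel N T_L T_R t x) =
      ENNReal.ofReal (Real.exp (2 * P.γ * t)) *
        ∫⁻ y, ∫⁻ x, H (x, y) ∂(P.langevinRevKernel N T_L T_R t y) := by
  haveI : (volume : Measure (PhaseSpace N)).IsAddHaarMeasure := Measure.prod.instIsAddHaarMeasure _ _
  have h := (hP.confinedDrift N).toConfinedDrift.lintegral_sdeKernel_duality
    (hP.reversedDrift N).toConfinedDrift
    (hP.noiseVecL_mem_noise N T_L) (hP.noiseVecR_mem_noise N T_R)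
    (hP.noiseVecL_mem_reversedDrift_noise N T_L) (hP.noiseVecR_mem_reversedDrift_noise N T_R)
    volume (fun _ => rfl) (P.trace_fderiv_langevinDrift_U2 hP.contDiff_U hP.contDiff_V hN) ht hH
  rw [show -(-(2 * P.γ) * (t : ℝ)) = 2 * P.γ * t by ring] at h
  exact h

/-- Duality, Bochner form: for `H` integrable against `dx P_t(x, dy)`, the swapped function is
integrable against `dy P̂_t(y, dx)` and `∫ dx ∫ P_t(x,dy) H = e^{2γt} ∫ dy ∫ P̂_t(y,dx) H`.
[folklore] -/
theorem integral_langevinKernel_duality {t : ℝ≥0} (ht : 0 < t)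
    {H : PhaseSpace N × PhaseSpace N → ℝ}
    (hH : Integrable H ((volume : Measure (PhaseSpace N)) ⊗ₘ P.langevinKernel N T_L T_R t)) :
    Integrable (fun p : PhaseSpace N × PhaseSpace N => H p.swap)
        ((volume : Measure (PhaseSpace N)) ⊗ₘ P.langevinRevKernel N T_L T_R t) ∧
      ∫ x, ∫ y, H (x, y) ∂(P.langevinKernel N T_L T_R t x) =
        Real.exp (2 * P.γ * t) * ∫ y, ∫ x, H (x, y) ∂(P.langevinRevKernel N T_L T_R t y) := by
  haveI : (volume : Measure (PhaseSpace N)).IsAddHaarMeasure := Measure.prod.instIsAddHaarMeasure _ _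
  have h := (hP.confinedDrift N).toConfinedDrift.integral_sdeKernel_duality
    (hP.reversedDrift N).toConfinedDrift
    (hP.noiseVecL_mem_noise N T_L) (hP.noiseVecR_mem_noise N T_R)
    (hP.noiseVecL_mem_reversedDrift_noise N T_L) (hP.noiseVecR_mem_reversedDrift_noise N T_R)
    volume (fun _ => rfl) (P.trace_fderiv_langevinDrift_U2 hP.contDiff_U hP.contDiff_V hN) ht hH
  rw [show -(-(2 * P.γ) * (t : ℝ)) = 2 * P.γ * t by ring] at h
  exact h

/-- **Lebesgue measure is an eigenmeasure of the reversed kernels**: `∫ P̂_t(y, A) dy = e^{-2γt}|A|`.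
[folklore] -/
theorem lintegral_langevinRevKernel_apply {t : ℝ≥0} (ht : 0 < t) {A : Set (PhaseSpace N)}
    (hA : MeasurableSet A) :
    ∫⁻ y, P.langevinRevKernel N T_L T_R t y A =
      ENNReal.ofReal (Real.exp (-(2 * P.γ * t))) * volume A := by
  haveI : (volume : Measure (PhaseSpace N)).IsAddHaarMeasure := Measure.prod.instIsAddHaarMeasure _ _
  have h := (hP.confinedDrift N).toConfinedDrift.lintegral_sdeKernel_rev_apply
    (hP.reversedDrift N).toConfinedDrift
    (hP.noiseVecL_mem_noise N T_L) (hP.noiseVecR_mem_noise N T_R)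
    (hP.noiseVecL_mem_reversedDrift_noise N T_L) (hP.noiseVecR_mem_reversedDrift_noise N T_R)
    volume (fun _ => rfl) (P.trace_fderiv_langevinDrift_U2 hP.contDiff_U hP.contDiff_V hN) ht hA
  rw [show -(2 * P.γ) * (t : ℝ) = -(2 * P.γ * t) by ring] at h
  exact h

/-- **Lebesgue measure is contracted by the reversed kernels**: `∫ dy ∫ g dP̂_t(y,·) ≤ ∫ g dx` for
measurable `g ≥ 0` and `t > 0` (duality, `e^{2γt} ≥ 1`). [folklore] -/
theorem lintegral_langevinRevKernel_le {t : ℝ≥0} (ht : 0 < t) {g : PhaseSpace N → ℝ≥0∞}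
    (hg : Measurable g) :
    ∫⁻ y, ∫⁻ x, g x ∂(P.langevinRevKernel N T_L T_R t y) ≤ ∫⁻ x, g x := by
  haveI : ∀ x, IsProbabilityMeasure (P.langevinKernel N T_L T_R t x) := fun x =>
    (hP.isMarkovKernel_langevinKernel N T_L T_R t).isProbabilityMeasure x
  have hdual := hP.lintegral_langevinKernel_duality T_L T_R hN ht
    (H := fun p : PhaseSpace N × PhaseSpace N => g p.1) (hg.comp measurable_fst)
  simp only [lintegral_const, measure_univ, mul_one] at hdual
  have h1 : (1 : ℝ≥0∞) ≤ ENNReal.ofReal (Real.exp (2 * P.γ * t)) := by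
    rw [← ENNReal.ofReal_one]
    exact ENNReal.ofReal_le_ofReal (Real.one_le_exp (by
      have := hP.γ_nonneg; have := t.coe_nonneg; positivity))
  calc ∫⁻ y, ∫⁻ x, g x ∂(P.langevinRevKernel N T_L T_R t y)
      ≤ ENNReal.ofReal (Real.exp (2 * P.γ * t)) *
          ∫⁻ y, ∫⁻ x, g x ∂(P.langevinRevKernel N T_L T_R t y) := le_mul_of_one_le_left' h1
    _ = ∫⁻ x, g x := hdual.symm

end UniformlyConfining

end SiteChain

end Literature.MathematicalPhysics.KineticTheory.HeatConduction
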